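import Literature.NumberTheory.EllipticCurves.IwasawaSelmerControlAwayFromPProofs
import HarnessLib

/-!
# The `p`-power torsion of coinvariants is EXACTLY `B/f(B)` when `M/B` is `p`-divisible
# (`B = M[p^∞]`): the equality behind brick B4 of the GLOBAL count (C) (cell `b2b-bsdres`,
# CLASS-CLOSURE lane, class O10 — x1b GEN 35, class lead; file 50 of the series: B4, part 1 —
# pure algebra)

HONEST FRAMING (cell `b2b-bsdres`, run/shared/lean/b2b/bsd-rank1-residual/, verbatim in every
file): the goal of the cell is to DELETE the COMBINATION-SHAPED residual classes of the
Birch–Swinnerton-Dyer formula for ALL analytic-rank `≤ 1` elliptic curves over `ℚ` — "full BSD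
formula for every rank `≤ 1` curve in class `C`" assembled STRICTLY from published theorems — so
that the rank-`≤ 1` remainder becomes exactly the CONSTRUCTION-SHAPED classes, which are TYPED
(missing-input `Prop`s), NOT attempted. This is not "finishing BSD". CLASS-CLOSURE lane: prove
what is provable now; shrink each hard class to its core with data; no claim beyond stated classes;
research routes on CONSTRUCTION-SHAPED X12 / O10; census / instrument output = EVIDENCE / conjecture
items, NEVER a Literature fact; `RESIDUAL-MAP.md` marks change only by signed lines. THIS FILE:
TOOL THEOREMS ONLY (pure algebra over the tree's `PrimaryCoinvariants` vocabulary of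
`IwasawaSelmerControlAwayFromPProofs`) — no definition, no named Literature fact, no Summits-side
fact `def … : Prop`, no `sorry`, axioms standard; nothing is booked; no label / mark / count /
sub-cell moves; (C1_η), (C2_η-GZ), (C3_η) stay typed as filed; O10 stays OPEN /
CONSTRUCTION-SHAPED; nothing about `BSD(W, p)` of any pair is claimed.

## What (brick B4 of `HSUM-UNCONDITIONAL-x1b.md` §3b / `B2-LOCALISATION-x1b.md` §3, step (i))

The tree's `PrimaryCoinvariants.finite_primaryComponent_quotient` (Greenberg, LNM 1716, §3, proof
of Lemma 3.3, p. 87) gives, for an additive endomorphism `f` of `M` with `B = M[p^∞]` and `M/B`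
`p`-divisible, a SURJECTION `B/f(B) ↠ (M/f(M))[p^∞]`, whence the inequality
`#(M/f(M))[p^∞] ≤ #(B/f(B))` used by n1011's `#𝒦_{v,0}[p^∞] ≤ p^{ord_p c_v}`
(`Iwasawa/LocalTowerKernelCardLeTamagawa.lean`). Here the map is shown INJECTIVE as well when
`B/f(B)` is finite: if `b = f(y)` with `b ∈ B`, write `y = pᵏ y' + c` with `c ∈ B` (`M/B` is
`p`-divisible), so `b = f(c) + pᵏ f(y')` with `f(y') ∈ B` (saturation), and `pᵏ` kills `B/f(B)` for
`k` large — the class of `b` in `B/f(B)` is `0`. Equivalently: the connecting map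
`(M/B)^{f} → B/f(B)` of the snake lemma vanishes, a `p`-divisible group having no non-zero map to a
finite `p`-group. Results:

* `exists_pow_smul_eq_zero_of_finite` — a finite group all of whose elements are `p`-power
  torsion is killed by one power of `p`;
* `quotientMap_injective` — `B/f(B) → M/f(M)` is injective;
* **`natCard_primaryComponent_quotient_eq`** — `#(M/f(M))[p^∞] = #(B/f(B))`.

With n1011's bridge `B ≃ B_v` and X11b's `[B_v : (γ_v − 1)B_v] = p^{ord_p c_v}` this makes the
coinvariant side of Greenberg's local count EXACT (`#(M_∞/(g−1)M_∞)[p^∞] = p^{ord_p c_v}` at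
`v ∤ p`); the remaining step of B4 is the surjectivity of `𝒦_{v,0}[p^∞] ↪ (M_∞/(g−1)M_∞)[p^∞]`
(inflation cocycles for `b ∈ B`).

References: [GreenbergLNM1716] R. Greenberg, LNM 1716 (1999), §3 Lemma 3.3 (proof, p. 87), §4
proof of Thm. 4.1 (p. 74: "`ker r_v` has order `c_v^{(p)}`").
-/

noncomputable section

open scoped Classical

namespace Summit.BirchSwinnertonDyer.Rank1Residual.Additive

namespace PrimaryCoinvariantsExact

open Literature.NumberTheory.EllipticCurves Literature.NumberTheory.EllipticCurves.PrimaryCoinvariants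

variable {M : Type*} [AddCommGroup M] (p : ℕ)

/-- A finite abelian group all of whose elements are `p`-power torsion is killed by ONE power of
`p` (take the maximum exponent over the finite set). [folklore] -/
theorem exists_pow_smul_eq_zero_of_finite {Q : Type*} [AddCommGroup Q] [Finite Q]
    (h : ∀ q : Q, ∃ k : ℕ, p ^ k • q = 0) : ∃ k : ℕ, ∀ q : Q, p ^ k • q = 0 := by
  haveI := Fintype.ofFinite Q
  choose k hk using h
  refine ⟨Finset.univ.sup k, fun q ↦ ?_⟩
  obtain ⟨j, hj⟩ := Nat.exists_eq_add_of_le (Finset.le_sup (f := k) (Finset.mem_univ q))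
  rw [hj, pow_add, mul_comm, mul_smul, hk q, smul_zero]

/-- Every class of `B/f(B)`, `B = M[p^∞]`, is `p`-power torsion. [folklore] -/
theorem exists_pow_smul_mk_eq_zero
    (fB : AddCommGroup.primaryComponent M p →+ AddCommGroup.primaryComponent M p)
    (q : AddCommGroup.primaryComponent M p ⧸ fB.range) : ∃ k : ℕ, p ^ k • q = 0 := by
  induction q using QuotientAddGroup.induction_on with
  | H b =>
    obtain ⟨k, hk⟩ := (mem_primaryComponent_iff_exists_nsmul p (b : M)).mp b.2
    refine ⟨k, ?_⟩
    rw [← QuotientAddGroup.mk_nsmul]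
    have hb : p ^ k • b = 0 := Subtype.ext (by rw [AddSubgroupClass.coe_nsmul, hk, ZeroMemClass.coe_zero])
    rw [hb, QuotientAddGroup.mk_zero]

/-- **`B/f(B) → M/f(M)` is injective** (`B = M[p^∞]`, `M/B` `p`-divisible, `B/f(B)` finite): for
`b = f(y) ∈ B`, `y = pᵏ y' + c` with `c ∈ B`, so `b − f(c) = pᵏ f(y')` with `f(y') ∈ B`, and `pᵏ`
kills `B/f(B)`. (The connecting map `(M/B)^f → B/f(B)` is zero.) [cite: GreenbergLNM1716, §3 Lemma 3.3 (proof, p. 87)] -/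
theorem quotientMap_injective (f : M →+ M)
    (fB : AddCommGroup.primaryComponent M p →+ AddCommGroup.primaryComponent M p)
    (hfB : ∀ b, (fB b : M) = f b)
    (hdiv : ∀ y : M, ∃ y' : M, y - p • y' ∈ AddCommGroup.primaryComponent M p)
    [Finite (AddCommGroup.primaryComponent M p ⧸ fB.range)] :
    Function.Injective (QuotientAddGroup.map fB.range f.range (AddCommGroup.primaryComponent M p).subtype
      (by rintro _ ⟨b, rfl⟩; exact ⟨(b : M), (hfB b).symm⟩)) := by
  obtain ⟨k, hk⟩ := exists_pow_smul_eq_zero_of_finite p (exists_pow_smul_mk_eq_zero p fB)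
  rw [injective_iff_map_eq_zero]
  intro q hq
  induction q using QuotientAddGroup.induction_on with
  | H b =>
    rw [QuotientAddGroup.map_mk, QuotientAddGroup.eq_zero_iff] at hq
    obtain ⟨y, hy'⟩ := hq
    have hy : f y = (b : M) := hy'
    -- `y = p^k y' + c`, `c ∈ B`
    obtain ⟨y', hy'⟩ := exists_sub_pow_smul_mem p hdiv k y
    set c : AddCommGroup.primaryComponent M p := ⟨y - p ^ k • y', hy'⟩ with hc
    -- `f(y') ∈ B`: `p^k • f y' = b − f c ∈ B`
    have hfy' : f y' ∈ AddCommGroup.primaryComponent M p := by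
      refine mem_primaryComponent_of_nsmul_mem p (k := k) ?_
      have e : p ^ k • f y' = (b : M) - f (c : M) := by
        rw [hc]
        change p ^ k • f y' = (b : M) - f (y - p ^ k • y')
        rw [map_sub, map_nsmul, hy]
        abel
      rw [e]
      exact sub_mem b.2 (map_mem_primaryComponent p f hy')
    -- the class of `b` is `[fB c] + p^k • [⟨f y', _⟩] = 0`
    have hbeq : b = fB c + p ^ k • (⟨f y', hfy'⟩ : AddCommGroup.primaryComponent M p) := by
      apply Subtype.ext
      rw [AddMemClass.coe_add, hfB, AddSubgroupClass.coe_nsmul]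
      change (b : M) = f (y - p ^ k • y') + p ^ k • f y'
      rw [map_sub, map_nsmul, hy]
      abel
    rw [hbeq, QuotientAddGroup.mk_add, QuotientAddGroup.mk_nsmul, hk, add_zero,
      QuotientAddGroup.eq_zero_iff]
    exact ⟨c, rfl⟩

/-- **`#(M/f(M))[p^∞] = #(B/f(B))`** (`B = M[p^∞]`, `M/B` `p`-divisible, `B/f(B)` finite): the map
`B/f(B) → M/f(M)` is injective (`quotientMap_injective`) with image exactly the `p`-power torsion
of `M/f(M)` (the tree's `finite_primaryComponent_quotient`). Greenberg, LNM 1716, §3, proof of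
Lemma 3.3 (p. 87): the uniquely `p`-divisible part contributes nothing to `ker(r_v)`.
[cite: GreenbergLNM1716, §3 Lemma 3.3 (proof, p. 87)] -/
theorem natCard_primaryComponent_quotient_eq (f : M →+ M)
    (fB : AddCommGroup.primaryComponent M p →+ AddCommGroup.primaryComponent M p)
    (hfB : ∀ b, (fB b : M) = f b)
    (hdiv : ∀ y : M, ∃ y' : M, y - p • y' ∈ AddCommGroup.primaryComponent M p)
    [Finite (AddCommGroup.primaryComponent M p ⧸ fB.range)] :
    Nat.card (AddCommGroup.primaryComponent (M ⧸ f.range) p) =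
      Nat.card (AddCommGroup.primaryComponent M p ⧸ fB.range) := by
  let π : AddCommGroup.primaryComponent M p ⧸ fB.range →+ M ⧸ f.range :=
    QuotientAddGroup.map fB.range f.range (AddCommGroup.primaryComponent M p).subtype
      (by rintro _ ⟨b, rfl⟩; exact ⟨(b : M), (hfB b).symm⟩)
  have hπinj : Function.Injective π := quotientMap_injective p f fB hfB hdiv
  have hπ : ∀ b : AddCommGroup.primaryComponent M p,
      π (b : AddCommGroup.primaryComponent M p ⧸ fB.range) = ((b : M) : M ⧸ f.range) :=
    fun b ↦ QuotientAddGroup.map_mk _ _ _ _ b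
  -- the range of `π` is the `p`-primary component of `M/f(M)`
  have hrange : (π.range : Set (M ⧸ f.range)) = AddCommGroup.primaryComponent (M ⧸ f.range) p := by
    apply Set.Subset.antisymm
    · rintro _ ⟨q, rfl⟩
      induction q using QuotientAddGroup.induction_on with
      | H b =>
        rw [SetLike.mem_coe, mem_primaryComponent_iff_exists_nsmul]
        obtain ⟨k, hk⟩ := (mem_primaryComponent_iff_exists_nsmul p (b : M)).mp b.2
        refine ⟨k, ?_⟩
        change p ^ k • π (b : AddCommGroup.primaryComponent M p ⧸ fB.range) = 0
        rw [hπ, ← QuotientAddGroup.mk_nsmul, hk, QuotientAddGroup.mk_zero]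
    · intro q hq
      induction q using QuotientAddGroup.induction_on with
      | H x =>
        rw [SetLike.mem_coe, mem_primaryComponent_iff_exists_nsmul] at hq
        obtain ⟨k, hk⟩ := hq
        rw [← QuotientAddGroup.mk_nsmul, QuotientAddGroup.eq_zero_iff] at hk
        obtain ⟨y, hy⟩ := hk
        obtain ⟨y', hy'⟩ := exists_sub_pow_smul_mem p hdiv k y
        have hmem : x - f y' ∈ AddCommGroup.primaryComponent M p := by
          refine mem_primaryComponent_of_nsmul_mem p (k := k) ?_
          have e : p ^ k • (x - f y') = f (y - p ^ k • y') := by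
            rw [smul_sub, map_sub, map_nsmul, hy]
          rw [e]
          exact map_mem_primaryComponent p f hy'
        refine ⟨((⟨x - f y', hmem⟩ : AddCommGroup.primaryComponent M p) :
          AddCommGroup.primaryComponent M p ⧸ fB.range), ?_⟩
        rw [hπ, QuotientAddGroup.eq_iff_sub_mem]
        refine ⟨-y', ?_⟩
        change f (-y') = (x - f y') - x
        rw [map_neg]; abel
  calc Nat.card (AddCommGroup.primaryComponent (M ⧸ f.range) p)
      = Nat.card π.range := Nat.card_congr (Equiv.setCongr hrange.symm)
    _ = Nat.card (AddCommGroup.primaryComponent M p ⧸ fB.range) :=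
        (Nat.card_congr (AddMonoidHom.ofInjective hπinj).toEquiv).symm

end PrimaryCoinvariantsExact

end Summit.BirchSwinnertonDyer.Rank1Residual.Additive

end
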